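import Summits.BirchSwinnertonDyer.BirchSwinnertonDyer.Theorems.ThetaPartnerAtTwoSignedControlAtTwoShaThreeBaseIndexTwo
import Literature.NumberTheory.GaloisRepresentations.Corestriction
import Mathlib.Topology.Instances.ZMod
import HarnessLib

/-!
# The Gysin sequence of an index-`2` subgroup in degree `2`: a class of `H²(G, T)` dying on `U` is `φ ∪ χ_U`, hence a
# corestriction from any `S'` with `χ_U ∈ cor H¹(S', ℤ/2)` (K4 `SignedControlAtTwo`, base case of Milne I 4.10 (c)₃)

Route `ThetaPartnerAtTwo` (TP2), crux K4 `SignedControlAtTwo` (stmt-BirchSwinnertonDyer-20309), line `eulerchar` v12, stub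
`stub_poitouTateThreeRealRat`; width seat `bsd-wall-tp2-p3-w2` gen 7 (`--supports stmt-BirchSwinnertonDyer-20309`, helper).
Group-cohomological brick of the `hbase` road (`Cruxes/SignedControlAtTwo/HBASE-ROAD-w2g7.md`, steps N2–N5): `G` profinite, `U ≤ G`
open of index `2`, `T` a discrete `G`-module with TRIVIAL action and `2T = 0`, `χ_U : G → ℤ/2` the character with kernel `U`
(as a `1`-cocycle of the trivial module `ℤ/2`).

* `exists_smulPairing` — the pairing `T × ℤ/2 → T`, `(t, a) ↦ a t` (exists since `2T = 0`).
* `twoCocycleClass_cup_comm` — graded commutativity for `1`-classes of trivial modules of exponent `2`.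
* **`eq_cupProduct_of_resH_two_eq_zero`** — if `res_U c = 0` then `c = [φ] ∪ [χ_U]` for a continuous homomorphism
  `φ : G → T` (exactness `H¹(G,T) →∪χ_U→ H²(G,T) →res→ H²(U,T)`: `res = sh ∘ H²(unit)`, Shapiro injectivity, `ker H²(unit) = im δ₁`
  for `0 → T → M_G^U(T) → T → 0` (`…ShaThreeBaseIndexTwo.isSES_unitCoind_normCoind`), and `δ₁ φ = χ_U ∪ φ` computed on the
  indicator lift).
* **`mem_range_cor_of_resH_two_eq_zero`** — if moreover `[χ_U] = cor_{S'} u` for a closed subgroup `S'` of finite index and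
  `u ∈ H¹(S', ℤ/2)`, then `c ∈ cor_{S'}(H²(S', T))` (the tree's projection formula `cor (res a ∪ b) = a ∪ cor b`).

HONEST FRAMING: THEOREMS ONLY (no definition, no named fact, no `sorry`); closes no item; BSD is not proved by any of this.
References: [SerreGaloisCohomology1997] I §2.5, I §2.6 Ex. 2; [NeukirchSchmidtWingberg2008] I §3, I §5 Prop. (1.5.3)(iv).
-/

set_option autoImplicit false
-- the Theorems namespace of this sub repeats the summit name by design (D-0017 nested layout)
set_option linter.dupNamespace false

noncomputable section

open CategoryTheory Function
open _root_.TopRep _root_.ContRepresentation _root_.ContinuousCohomology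
open Literature.NumberTheory.GaloisRepresentations

namespace Summit.BirchSwinnertonDyer.BirchSwinnertonDyer.Theorems.SignedEC.ShaThreeBase

section Gysin

variable {G : Type} [Group G] [TopologicalSpace G] [IsTopologicalGroup G] [CompactSpace G]
  [T2Space G] [TotallyDisconnectedSpace G]
variable {T : Type} [AddCommGroup T] [TopologicalSpace T] [DiscreteTopology T]
variable (ρ : ContinuousRep G ℤ T)

omit [IsTopologicalGroup G] [CompactSpace G] [T2Space G] [TotallyDisconnectedSpace G] in
/-- **The pairing `T × ℤ/2 → T`, `(t, a) ↦ a·t`** (`2T = 0`): a continuous `G`-equivariant pairing of the trivial modules `T` and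
`ℤ/2` into `T`, characterised by `P t 0 = 0`, `P t 1 = t`. [folklore] -/
theorem exists_smulPairing (htriv : ∀ (x : G) (t : T), ρ x t = t) (h2 : ∀ t : T, 2 • t = 0) :
    ∃ P : ContPairing ρ.toTopRep (ContinuousRep.trivial G ℤ (ZMod 2)).toTopRep ρ.toTopRep,
      ∀ (t : T) (a : ZMod 2), P.toLin t a = if a = 0 then 0 else t := by
  classical
  have h2z : ∀ t : T, (2 : ℤ) • t = 0 := fun t => by rw [two_zsmul, ← two_nsmul, h2]
  have hval : ∀ (n : ℤ) (t : T), n • t = if ((n : ZMod 2) = 0) then 0 else t := fun n t => by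
    by_cases hn : (2 : ℤ) ∣ n
    · have hif : ((n : ZMod 2) = 0) := (ZMod.intCast_zmod_eq_zero_iff_dvd n 2).2 hn
      obtain ⟨k, rfl⟩ := hn
      rw [if_pos hif, mul_comm, mul_smul, h2z, smul_zero]
    · have hodd : Odd n := Int.not_even_iff_odd.1 (fun h => hn (even_iff_two_dvd.1 h))
      obtain ⟨k, rfl⟩ := hodd
      rw [if_neg (fun h => hn ((ZMod.intCast_zmod_eq_zero_iff_dvd _ 2).1 h)), add_zsmul, one_zsmul, mul_comm,
        mul_smul, h2z, smul_zero, zero_add]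
  let B : T →ₗ[ℤ] ZMod 2 →ₗ[ℤ] T :=
    LinearMap.mk₂ ℤ (fun t a => if a = 0 then 0 else t)
      (fun t t' a => by split_ifs <;> simp)
      (fun n t a => by split_ifs <;> simp)
      (fun t a b => by
        obtain ⟨m, rfl⟩ := ZMod.intCast_surjective a
        obtain ⟨n, rfl⟩ := ZMod.intCast_surjective b
        rw [← Int.cast_add, ← hval, ← hval, ← hval, add_zsmul])
      (fun n t a => by
        obtain ⟨m, rfl⟩ := ZMod.intCast_surjective a
        rw [zsmul_eq_mul, ← Int.cast_mul, ← hval, ← hval, mul_zsmul])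
  refine ⟨ContPairing.ofDiscrete B fun g t a => ?_, fun t a => rfl⟩
  change B (ρ g t) a = ρ g (B t a)
  rw [htriv, htriv]

omit [CompactSpace G] [T2Space G] [TotallyDisconnectedSpace G] in
/-- **Graded commutativity in bidegree `(1,1)` for trivial modules of exponent `2`**: for a pairing `P : X × Y → T` of modules
with trivial action and `2T = 0`, the cocycles `(σ, τ) ↦ P(f σ, g τ)` and `(σ, τ) ↦ P(f τ, g σ)` have the same class (their sum is
the coboundary of `σ ↦ P(f σ, g σ)`). [cite: NeukirchSchmidtWingberg2008, I §4] -/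
theorem twoCocycleClass_cup_comm [LocallyCompactSpace G] (h2 : ∀ t : T, 2 • t = 0)
    {X Y : Type} [AddCommGroup X] [TopologicalSpace X] [DiscreteTopology X]
    [AddCommGroup Y] [TopologicalSpace Y] [DiscreteTopology Y]
    (ρX : ContinuousRep G ℤ X) (ρY : ContinuousRep G ℤ Y) (htriv : ∀ (x : G) (t : T), ρ x t = t)
    (hX : ∀ (x : G) (v : X), ρX x v = v) (hY : ∀ (x : G) (v : Y), ρY x v = v)
    (P : ContPairing ρX.toTopRep ρY.toTopRep ρ.toTopRep) (f : contOneCocycles ρX.toTopRep) (g : contOneCocycles ρY.toTopRep)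
    (z : contTwoCocycles ρ.toTopRep) (hz : ∀ σ τ, z.1 (σ, τ) = P.toLin (f.1 τ) (g.1 σ)) :
    twoCocycleClass _ z = twoCocycleClass _ (P.cupCocycle f g) := by
  have hneg : ∀ t : T, -t = t := fun t => by rw [neg_eq_iff_add_eq_zero, ← two_nsmul]; exact h2 t
  have hf : ∀ σ τ, f.1 (σ * τ) = f.1 σ + f.1 τ := fun σ τ => by
    have := f.2 σ τ
    rw [this]; change f.1 σ + ρX σ (f.1 τ) = _; rw [hX]
  have hg : ∀ σ τ, g.1 (σ * τ) = g.1 σ + g.1 τ := fun σ τ => by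
    have := g.2 σ τ
    rw [this]; change g.1 σ + ρY σ (g.1 τ) = _; rw [hY]
  rw [← sub_eq_zero, ← twoCocycleClass_sub, twoCocycleClass_eq_zero_iff]
  refine ⟨⟨fun σ => P.toLin (f.1 σ) (g.1 σ), P.continuous_toLin.comp (f.1.continuous.prodMk g.1.continuous)⟩,
    fun σ τ => ?_⟩
  change z.1 (σ, τ) - (P.cupCocycle f g).1 (σ, τ) = ρ σ (P.toLin (f.1 τ) (g.1 τ)) - P.toLin (f.1 (σ * τ)) (g.1 (σ * τ)) +
    P.toLin (f.1 σ) (g.1 σ)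
  rw [hz, ContPairing.cupCocycle_apply_eq_smul, htriv, hf, hg]
  change _ - P.toLin (f.1 σ) (ρY σ (g.1 τ)) = _
  rw [hY]
  simp only [map_add, LinearMap.add_apply]
  conv_lhs => rw [← hneg (P.toLin (f.1 τ) (g.1 σ))]
  abel

variable {U : Subgroup G}

/-- **`res_U c = 0 ⇒ c = [φ] ∪ [χ_U]`** (`U` open of index `2`, `T` trivial with `2T = 0`, `χ_U : G → ℤ/2` the character with
kernel `U`, pairing `(t, a) ↦ a t`): `res = sh ∘ H²(unit)` and Shapiro injectivity give `H²(unit) c = 0`; exactness of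
`0 → T → M_G^U(T) → T → 0` at `H²(T)` gives `c = δ₁ φ`; and the connecting cocycle of the indicator lift `σ ↦ 𝟙_U · φ(σ)` of `φ` is
`(σ, τ) ↦ χ_U(σ) φ(τ)`, cohomologous to `φ ∪ χ_U`. [cite: SerreGaloisCohomology1997, I §2.6 Exercise 2]
[cite: NeukirchSchmidtWingberg2008, I §3] -/
theorem eq_cupProduct_of_resH_two_eq_zero [Fintype (G ⧸ U)] (htriv : ∀ (x : G) (t : T), ρ x t = t) (h2 : ∀ t : T, 2 • t = 0)
    (hUo : IsOpen (U : Set G)) (hidx : U.index = 2)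
    (P : ContPairing ρ.toTopRep (ContinuousRep.trivial G ℤ (ZMod 2)).toTopRep ρ.toTopRep)
    (hP : ∀ (t : T) (a : ZMod 2), P.toLin t a = if a = 0 then 0 else t)
    (χ : contOneCocycles (ContinuousRep.trivial G ℤ (ZMod 2)).toTopRep) (hχU : ∀ σ, χ.1 σ = 0 ↔ σ ∈ U)
    (c : continuousCohomology 2 ρ.toTopRep) (hc : resH U ρ 2 c = 0) :
    ∃ φ : contOneCocycles ρ.toTopRep, c = P.cupProduct (oneCocycleClass _ φ) (oneCocycleClass _ χ) := by
  classical
  haveI : IsClosed (U : Set G) := Subgroup.isClosed_of_isOpen U hUo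
  haveI : DiscreteTopology (coindModule (ρ.restrict (subgroupIncl U))) := discreteTopology_coind _
  have hSES := isSES_unitCoind_normCoind ρ htriv h2 hUo hidx
  obtain ⟨σ₀, hσ₀⟩ := exists_not_mem_of_index_two hidx
  -- `H²(unit) c = 0`
  have h1 := resH_eq_shMap_unitCoind (S := U) ρ 2 c
  rw [hc] at h1
  have h0 : cohomologyMap (unitCoind (S := U) ρ) 2 c = 0 :=
    map_shapiro_eq_zero_imp (ρ.restrict (subgroupIncl U)) 1 _ (by
      change shMap U ρ 2 (cohomologyMap (unitCoind (S := U) ρ) 2 c) = 0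
      exact h1.symm)
  -- `c = δ₁ x`, `x = [push bt]`
  obtain ⟨x, hx⟩ := hSES.exists_δ₁_eq_of_map_two_eq_zero c h0
  obtain ⟨ψ, rfl⟩ := oneCocycleClass_surjective _ x
  -- the homomorphism `φ = ψ : G → T`
  refine ⟨ψ, ?_⟩
  have hψ : ∀ σ τ, ψ.1 (σ * τ) = ψ.1 σ + ψ.1 τ := fun σ τ => by
    have := ψ.2 σ τ
    rw [this]; change ψ.1 σ + ρ σ (ψ.1 τ) = _; rw [htriv]
  -- the indicator lift `σ ↦ 𝟙_U · ψ(σ)`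
  have hcont : ∀ t : T, Continuous ((U : Set G).indicator (fun _ : G => t)) := fun t => by
    refine IsLocallyConstant.continuous ((IsLocallyConstant.iff_exists_open _).2 fun y => ?_)
    by_cases hy : y ∈ U
    · refine ⟨U, hUo, hy, fun y' hy' => ?_⟩
      rw [Set.indicator_of_mem (show y' ∈ (U : Set G) from hy'), Set.indicator_of_mem (show y ∈ (U : Set G) from hy)]
    · refine ⟨(U : Set G)ᶜ, (Subgroup.isClosed_of_isOpen U hUo).isOpen_compl, hy, fun y' hy' => ?_⟩
      rw [Set.indicator_of_notMem (show y' ∉ (U : Set G) from hy'), Set.indicator_of_notMem (show y ∉ (U : Set G) from hy)]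
  have hmem : ∀ t : T, (⟨_, hcont t⟩ : C(G, T)) ∈ coindModule (ρ.restrict (subgroupIncl U)) := fun t s y => by
    change (U : Set G).indicator (fun _ => t) ((s : G) * y) = ρ (subgroupIncl U s) ((U : Set G).indicator (fun _ => t) y)
    rw [subgroupIncl_apply, htriv]
    by_cases hy : y ∈ U
    · rw [Set.indicator_of_mem (show y ∈ (U : Set G) from hy),
        Set.indicator_of_mem (show (s : G) * y ∈ (U : Set G) from U.mul_mem s.2 hy)]
    · rw [Set.indicator_of_notMem (show y ∉ (U : Set G) from hy),
        Set.indicator_of_notMem (show (s : G) * y ∉ (U : Set G) from fun h => hy ((Subgroup.mul_mem_cancel_left U s.2).1 h))]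
  let ind : T → coindModule (ρ.restrict (subgroupIncl U)) := fun t => ⟨_, hmem t⟩
  have hind_mem : ∀ (t : T) {y : G}, y ∈ U → (ind t : C(G, T)) y = t := fun t y hy => by
    change (U : Set G).indicator (fun _ => t) y = t
    exact Set.indicator_of_mem (show y ∈ (U : Set G) from hy) _
  have hind_not : ∀ (t : T) {y : G}, y ∉ U → (ind t : C(G, T)) y = 0 := fun t y hy => by
    change (U : Set G).indicator (fun _ => t) y = 0
    exact Set.indicator_of_notMem (show y ∉ (U : Set G) from hy) _
  have hnorm_ind : ∀ t, (normCoind ρ).hom (ind t) = t := fun t => by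
    rw [normCoind_hom_eq_of_index_two ρ htriv hidx hσ₀, hind_mem t U.one_mem,
      hind_not t (fun h => hσ₀ (by simpa using U.inv_mem h)), add_zero]
  let bt : C(G, coindModule (ρ.restrict (subgroupIncl U))) :=
    ⟨fun σ => ind (ψ.1 σ), (continuous_of_discreteTopology (f := ind)).comp ψ.1.continuous⟩
  have hbt : ∀ σ τ, (normCoind ρ).hom (bt (σ * τ)) = (normCoind ρ).hom (bt σ) + ρ σ ((normCoind ρ).hom (bt τ)) := fun σ τ => by
    change (normCoind ρ).hom (ind (ψ.1 (σ * τ))) = (normCoind ρ).hom (ind (ψ.1 σ)) + ρ σ ((normCoind ρ).hom (ind (ψ.1 τ)))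
    rw [hnorm_ind, hnorm_ind, hnorm_ind, htriv, hψ]
  have hpush : IsSES.pushCocycle bt hbt = ψ := Subtype.ext (ContinuousMap.ext fun σ => hnorm_ind (ψ.1 σ))
  rw [← hx, ← hpush, hSES.δ₁_oneCocycleClass bt hbt, hpush, ContPairing.cupProduct_oneCocycleClass_eq_twoCocycleClass]
  -- the connecting cocycle of the indicator lift is `(σ, τ) ↦ χ_U(σ) ψ(τ)`
  refine twoCocycleClass_cup_comm ρ h2 ρ (ContinuousRep.trivial G ℤ (ZMod 2)) htriv htriv (fun _ _ => rfl) P ψ χ _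
    fun σ τ => ?_
  apply hSES.injective
  rw [hSES.f_connectingCocycle_apply bt hbt σ τ]
  apply Subtype.ext
  apply ContinuousMap.ext
  intro y
  rw [unitCoind_hom_coe_apply, htriv, hP, Submodule.coe_add, Submodule.coe_sub, ContinuousMap.add_apply,
    ContinuousMap.sub_apply, coindRep_apply_apply]
  change (ind (ψ.1 τ) : C(G, T)) (y * σ) - (ind (ψ.1 (σ * τ)) : C(G, T)) y + (ind (ψ.1 σ) : C(G, T)) y = _
  rw [hψ]
  by_cases hσ : σ ∈ U
  · rw [if_pos ((hχU σ).2 hσ)]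
    by_cases hy : y ∈ U
    · rw [hind_mem _ (U.mul_mem hy hσ), hind_mem _ hy, hind_mem _ hy]; abel
    · rw [hind_not _ (fun h => hy ((Subgroup.mul_mem_cancel_right U hσ).1 h)), hind_not _ hy, hind_not _ hy]; abel
  · rw [if_neg (fun h => hσ ((hχU σ).1 h))]
    have hneg : ∀ t : T, -t = t := fun t => by rw [neg_eq_iff_add_eq_zero, ← two_nsmul]; exact h2 t
    by_cases hy : y ∈ U
    · rw [hind_not _ (fun h => hσ ((Subgroup.mul_mem_cancel_left U hy).1 h)), hind_mem _ hy, hind_mem _ hy,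
        show (0 : T) - (ψ.1 σ + ψ.1 τ) + ψ.1 σ = -ψ.1 τ by abel, hneg]
    · rw [hind_mem _ (mul_mem_of_not_mem_of_index_two hidx hy hσ), hind_not _ hy, hind_not _ hy, sub_zero, add_zero]

/-- **If `res_U c = 0` and `[χ_U] ∈ cor_{S'}(H¹(S', ℤ/2))`, then `c ∈ cor_{S'}(H²(S', T))`**: `c = [φ] ∪ [χ_U] = [φ] ∪ cor u =
cor (res [φ] ∪ u)` by the tree's projection formula `cor_cupProduct_resH`.
[cite: NeukirchSchmidtWingberg2008, I §5 Prop. (1.5.3)(iv)] [cite: SerreGaloisCohomology1997, I §2.5] -/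
theorem mem_range_cor_of_resH_two_eq_zero [Fintype (G ⧸ U)] (htriv : ∀ (x : G) (t : T), ρ x t = t)
    (h2 : ∀ t : T, 2 • t = 0) (hUo : IsOpen (U : Set G)) (hidx : U.index = 2)
    (χ : contOneCocycles (ContinuousRep.trivial G ℤ (ZMod 2)).toTopRep) (hχU : ∀ σ, χ.1 σ = 0 ↔ σ ∈ U)
    (S' : Subgroup G) [IsClosed (S' : Set G)] [Fintype (G ⧸ S')]
    (hu : oneCocycleClass _ χ ∈ Set.range (cor S' (ContinuousRep.trivial G ℤ (ZMod 2)) 1))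
    (c : continuousCohomology 2 ρ.toTopRep) (hc : resH U ρ 2 c = 0) : c ∈ Set.range (cor S' ρ 2) := by
  obtain ⟨P, hP⟩ := exists_smulPairing ρ htriv h2
  obtain ⟨φ, rfl⟩ := eq_cupProduct_of_resH_two_eq_zero ρ htriv h2 hUo hidx P hP χ hχU c hc
  obtain ⟨u, hu⟩ := hu
  rw [← hu, ← cor_cupProduct_resH S' ρ (ContinuousRep.trivial G ℤ (ZMod 2)) ρ P]
  exact ⟨_, rfl⟩

end Gysin

end Summit.BirchSwinnertonDyer.BirchSwinnertonDyer.Theorems.SignedEC.ShaThreeBase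

end
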